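import Summits.QuantumFields.YangMills.Theorems.BalabanUVNodesN21ChartExponentConvexity
import Summits.QuantumFields.YangMills.Theorems.BalabanUVNodesN21Sect1RemainderSecondOrderU1

/-!
# N21 (NE7c) · CONVEXITY OF THE [LF-II] (1.2) EXPONENT, ABELIAN MODEL INSTANCE THROUGH THE PEN's THEOREM: dag-n21-w3's ★
# `convexOn_expansion_of_quadraticRemainder` FED BY NAME with the `U(1)` second-order letters of p606810

Width seat pub-ymgap-dag-n21-w5 (g0; director-ym R399 (3a) ∕ №209 second wave, dag-lead WIDTH-209), node N21 = NE7c
(single-run shell-weight bound, NOT PRINTED in [Bałaban 1983–89], NOT proved), lane K3⁷ `SpineGivenEndpointR13SepCoPH`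
(stmt-QuantumFields-20544, `--kind proof --supports … --as helper`).  FILE 2 of the INPUTS ∕ MODEL-INSTANCE hand of
WIDTH-209 N21 piece 2 (pen dag-n21-w3 g3, «TAKE IT» I.29205).  Composes BY NAME: dag-n21-w3 g3's ★
`N21ChartExponentConvexity.convexOn_expansion_of_quadraticRemainder` (p606637 ✓: on a convex `K ⊆ (κ → ℝ)`, the expansion
`φ v = c + ½·Qf v + lin v + Vt v` with `Qf v = v ⬝ᵥ (A *ᵥ v)`, (1.9) for every `v`, `lin = ⇑ℓ`, and a QUADRATIC-REMAINDER
LETTER `|Vt y − Vt x − L_x(y − x)| ≤ Mq‖y − x‖²` is CONVEX under `4d(100M)^{d+1}·Mq ≤ γ₀`) and this seat's p606810 ✓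
`N21Sect1RemainderSecondOrderU1.abs_V12_div_quadraticRemainder_le` (that letter for the `U(1)` block action's (1.2) remainder
`g⁻²·V12 g ζ θ (∂H ·)`, with `Mq = gΦ` against the plaquette form `Σ_p ζ_p((∂H u)_p)²`).  THEOREMS ONLY: 0 `def`, 0 `sorry`.

WHAT.
* §1 `derivFunctionalU1_apply`: the derivative functional of `Vt = g⁻²·V12 g ζ θ (∂H ·)` at `x`, BUNDLED as the linear map
  `g⁻¹ • Σ_p (ζ_p·F_p(x)) • (proj_p ∘ ∂H)` (`F_p(x) = sin(θ_p + g(∂H x)_p) − sin θ_p − g(∂H x)_p cos θ_p`; no `def`), evaluates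
  to `g⁻¹·Σ_p ζ_p(∂H u)_p·F_p(x)`; `quadraticRemainderLetterU1_supNorm`: dag-n21-w3's `hVt` VERBATIM on the flat frame
  `κ → ℝ` (sup norm) — `|Vt y − Vt x − L_x(y − x)| ≤ (gΦc_φ)·‖y − x‖²` on the window `|(∂H v)_p| ≤ Φ` (`gΦ ≤ ½`), through
  the comparison letter `Σ_p ζ_p((∂H u)_p)² ≤ c_φ‖u‖²`.
* §2 ★ `convexOn_chartExponentU1` = THE PEN's ★ APPLIED: the abelian (1.2) exponent
  `c + ½·v ⬝ᵥ (A *ᵥ v) + ℓ v + g⁻²·V12 g ζ θ (∂H v)` is CONVEX on any convex window `K ⊆ {|(∂H v)_p| ≤ Φ}` under (1.9)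
  `∀ v` and the ONE clause `4d(100M)^{d+1}·(gΦc_φ) ≤ γ₀` — the model twin of p606810's ★ `convexOn_sect1ExponentU1`, now
  THROUGH `convexOn_expansion_of_quadraticRemainder`, so the two width hands of piece 2 meet BY NAME.
* §3 A6 (№189 (3)) `chartExponentU1_letters_inhabited`: one bond ∕ one plaquette (`κ = ι = Fin 1`), `∂H = id`, `A = 1`,
  `ℓ = 0`, `ζ = 1`, `θ = 0`, `g = ¼`, `K = B̄₁(0)`, rows at `γ₀ = 1, d = 1, M = 1∕100`, `c_φ = 1`: every binder of ★
  discharged, the clause WITH EQUALITY; the exponent is `½Σ_b v_b² + 16·V12 ¼ 1 0 v`.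

HONEST FRAMING.  Bookkeeping ∕ [textbook] over the tree's `U(1)` MODEL INSTANCE + composition BY NAME (p606637, p606810);
the identification of (ζ₀, θ, ∂H = ∂H_{1,k}, Φ, c_φ, A, ℓ) with [LF-II] (1.2)'s members is LOCATED typing (desk ME #34), NOT
asserted; the second-order row is NOT PRINTED (print: the value row *"O(g_k^{1−β})|Λ|"* only); abelian only (non-abelian
`D₃`∕BCH terms NOT reproduced); nothing of Bałaban's asserted; NE7c NOT PRINTED ∕ NOT proved; N21 NOT discharged; K3⁷ NOT
claimed; counts unmoved (typed 28∕28 · discharged 5∕27); count-neutral; one finite 𝕋⁴ at fixed ε — R4 would close only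
the conditional finite-𝕋⁴ rung `BalabanLadder.UV`, NOT the Yang–Mills mass gap (Clay); nothing about ℝ⁴ ∕ OS.
-/

set_option autoImplicit false

open Real Finset Set Matrix Metric

namespace Summit.QuantumFields.YangMills.Theorems.N21ChartExponentConvexityU1

open Literature.MathematicalPhysics.QuantumFieldTheory.Balaban1983to89.B16Txt357ThirdOrderU1 (V12)
open Literature.MathematicalPhysics.QuantumFieldTheory.Balaban1983to89.B16Sect1Wilson (Ineq19)
open Summit.QuantumFields.YangMills.Theorems.N21ChartExponentConvexity (convexOn_expansion_of_quadraticRemainder)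
open Summit.QuantumFields.YangMills.Theorems.N21Sect1RemainderSecondOrderU1 (abs_V12_div_quadraticRemainder_le)

variable {κ : Type*} [Fintype κ] {ι : Type*} [Fintype ι]

/-! ## §1  The `U(1)` quadratic-remainder letter in the pen's shape (flat frame `κ → ℝ`, sup norm, bundled `L_x`) -/

omit [Fintype κ] in
/-- the derivative functional of `g⁻²·V12 g ζ θ (∂H ·)` at `x`, bundled as the linear map
`g⁻¹ • Σ_p (ζ_p·F_p(x)) • (proj_p ∘ ∂H)` with `F_p(x) = sin(θ_p + g(∂H x)_p) − sin θ_p − g(∂H x)_p cos θ_p`, evaluates to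
`g⁻¹·Σ_p ζ_p·(∂H u)_p·F_p(x)`. [textbook] -/
theorem derivFunctionalU1_apply (g : ℝ) (ζ θ : ι → ℝ) (dH : (κ → ℝ) →ₗ[ℝ] (ι → ℝ)) (x u : κ → ℝ) :
    ((1 / g) • ∑ p, (ζ p * (sin (θ p + g * dH x p) - sin (θ p) - g * dH x p * cos (θ p))) •
        ((LinearMap.proj p).comp dH) : (κ → ℝ) →ₗ[ℝ] ℝ) u =
      1 / g * ∑ p, ζ p * dH u p * (sin (θ p + g * dH x p) - sin (θ p) - g * dH x p * cos (θ p)) := by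
  simp only [LinearMap.smul_apply, LinearMap.coe_sum, Finset.sum_apply, LinearMap.comp_apply,
    LinearMap.proj_apply, smul_eq_mul]
  congr 1
  exact Finset.sum_congr rfl fun p _ => by ring

/-- **THE `U(1)` QUADRATIC-REMAINDER LETTER IN THE PEN's SHAPE.**  On the flat frame `κ → ℝ` (sup norm), for
`Vt := g⁻²·V12 g ζ θ (∂H ·)` with `∂H` linear, `ζ ≥ 0`, the window `|(∂H v)_p| ≤ Φ` on `K` with `gΦ ≤ ½`, `0 ≤ Φ`, and the
comparison letter `Σ_p ζ_p((∂H u)_p)² ≤ c_φ‖u‖²`: dag-n21-w3's hypothesis `hVt` holds VERBATIM with `Mq = gΦc_φ` and the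
bundled derivative functional of §1 — `|Vt y − Vt x − L_x(y − x)| ≤ (gΦc_φ)·‖y − x‖²` (p606810's
`abs_V12_div_quadraticRemainder_le` + the comparison). [textbook] -/
theorem quadraticRemainderLetterU1_supNorm {g Φ cφ : ℝ} (hg : 0 < g) (hΦ : 0 ≤ Φ) (hgΦ : g * Φ ≤ 1 / 2)
    {ζ : ι → ℝ} (hζ : ∀ p, 0 ≤ ζ p) (θ : ι → ℝ) (dH : (κ → ℝ) →ₗ[ℝ] (ι → ℝ)) {K : Set (κ → ℝ)}
    (hwin : ∀ v ∈ K, ∀ p, |dH v p| ≤ Φ) (hcφ : ∀ u, ∑ p, ζ p * (dH u p) ^ 2 ≤ cφ * ‖u‖ ^ 2) :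
    ∀ x ∈ K, ∀ y ∈ K,
      |1 / g ^ 2 * V12 g ζ θ (dH y) - 1 / g ^ 2 * V12 g ζ θ (dH x) -
          ((1 / g) • ∑ p, (ζ p * (sin (θ p + g * dH x p) - sin (θ p) - g * dH x p * cos (θ p))) •
            ((LinearMap.proj p).comp dH) : (κ → ℝ) →ₗ[ℝ] ℝ) (y - x)|
        ≤ g * Φ * cφ * ‖y - x‖ ^ 2 := by
  intro x hx y hy
  rw [derivFunctionalU1_apply]
  calc |1 / g ^ 2 * V12 g ζ θ (dH y) - 1 / g ^ 2 * V12 g ζ θ (dH x)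
          - 1 / g * ∑ p, ζ p * dH (y - x) p * (sin (θ p + g * dH x p) - sin (θ p) - g * dH x p * cos (θ p))|
      ≤ g * Φ * ∑ p, ζ p * (dH (y - x) p) ^ 2 :=
        abs_V12_div_quadraticRemainder_le hg hgΦ hζ θ dH (hwin x hx) (hwin y hy)
    _ ≤ g * Φ * (cφ * ‖y - x‖ ^ 2) := mul_le_mul_of_nonneg_left (hcφ (y - x)) (mul_nonneg hg.le hΦ)
    _ = g * Φ * cφ * ‖y - x‖ ^ 2 := by ring

/-! ## §2  ★ The abelian (1.2) exponent is convex on the window, through the pen's ★ -/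

/-- ★ **CONVEXITY OF THE ABELIAN (1.2) EXPONENT, THROUGH dag-n21-w3's ★.**  On a convex window `K ⊆ (κ → ℝ)` with
`|(∂H v)_p| ≤ Φ` (`0 ≤ Φ`, `gΦ ≤ ½`; print: `χ({|B′| < M₀g_k⁻¹ε_k})`), the exponent
`φ v = c + ½·v ⬝ᵥ (A *ᵥ v) + ℓ v + g⁻²·V12 g ζ θ (∂H v)` ((1.2) with the `½`, desk ME #34: quadratic form, (1.5) linear
member, the abelian `V`-term of `B16Txt357ThirdOrderU1`) is CONVEX on `K` under (1.9) `Ineq19 (v ⬝ᵥ (A *ᵥ v)) (Σ_b v_b²) γ₀ d M`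
for every `v`, the comparison letter `Σ_p ζ_p((∂H u)_p)² ≤ c_φ‖u‖²`, and the ONE clause `4d(100M)^{d+1}·(gΦc_φ) ≤ γ₀`
(*"for g_k sufficiently small"* — p606810 `clauseU1_of_smallness` ∕ `eventually_smallnessU1`).  Proof: the pen's
`convexOn_expansion_of_quadraticRemainder` with `Mq := gΦc_φ` supplied by §1. [textbook] -/
theorem convexOn_chartExponentU1 {K : Set (κ → ℝ)} (hK : Convex ℝ K) (φ : (κ → ℝ) → ℝ) (c : ℝ) (A : Matrix κ κ ℝ)
    (ℓ : (κ → ℝ) →ₗ[ℝ] ℝ) (dH : (κ → ℝ) →ₗ[ℝ] (ι → ℝ)) {ζ : ι → ℝ} (θ : ι → ℝ) {g Φ cφ γ₀ M : ℝ} {d : ℕ}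
    (hg : 0 < g) (hΦ : 0 ≤ Φ) (hgΦ : g * Φ ≤ 1 / 2) (hζ : ∀ p, 0 ≤ ζ p) (hd : 1 ≤ d) (hM : 0 < M) (hγ₀ : 0 < γ₀)
    (hexp : ∀ v ∈ K, φ v = c + 1 / 2 * (v ⬝ᵥ (A *ᵥ v)) + ℓ v + 1 / g ^ 2 * V12 g ζ θ (dH v))
    (h19 : ∀ v, Ineq19 (v ⬝ᵥ (A *ᵥ v)) (∑ b, v b ^ 2) γ₀ d M)
    (hwin : ∀ v ∈ K, ∀ p, |dH v p| ≤ Φ)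
    (hcφ : ∀ u, ∑ p, ζ p * (dH u p) ^ 2 ≤ cφ * ‖u‖ ^ 2)
    (hclause : 4 * d * (100 * M) ^ (d + 1) * (g * Φ * cφ) ≤ γ₀) :
    ConvexOn ℝ K φ :=
  convexOn_expansion_of_quadraticRemainder hK φ (fun v => v ⬝ᵥ (A *ᵥ v)) (fun v => ℓ v)
    (fun v => 1 / g ^ 2 * V12 g ζ θ (dH v)) c hexp A (fun _ => rfl) hd hM hγ₀ h19 ℓ (fun _ => rfl)
    (fun x => (1 / g) • ∑ p, (ζ p * (sin (θ p + g * dH x p) - sin (θ p) - g * dH x p * cos (θ p))) •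
      ((LinearMap.proj p).comp dH))
    (quadraticRemainderLetterU1_supNorm hg hΦ hgΦ hζ θ dH hwin hcφ) hclause

/-! ## §3  A6 witness: every binder of ★ discharged on one bond ∕ one plaquette, the clause with equality -/

/-- **A6 WITNESS OF ★** (director-ym STANDING A6 RULE №189 (3)): one bond and one plaquette (`κ = ι = Fin 1`), `∂H = id`,
`A = 1`, `ℓ = 0`, `c = 0`, weight `ζ = 1`, background `θ = 0`, `g = ¼`, window `K = B̄₁(0)` (sup norm; `Φ = 1`, `gΦ = ¼`),
rows at `γ₀ = 1`, `d = 1`, `M = 1∕100` ((1.9): `½Σ_b v_b² ≤ v ⬝ᵥ v`), comparison `c_φ = 1` (`v₀² ≤ ‖v‖²`), and the clause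
`4·1·1·(¼·1·1) = 1 ≤ 1` WITH EQUALITY: ★ fires and certifies the exponent `½(v ⬝ᵥ v) + 16·V12 ¼ 1 0 v` convex on the
closed unit ball.  A satisfiability witness, not an estimate on Bałaban's measure. [textbook] -/
theorem chartExponentU1_letters_inhabited :
    ConvexOn ℝ (closedBall (0 : Fin 1 → ℝ) 1) (fun v : Fin 1 → ℝ =>
      1 / 2 * (v ⬝ᵥ v) + 16 * V12 (1 / 4) (fun _ : Fin 1 => (1 : ℝ)) (fun _ => 0) v) := by
  refine convexOn_chartExponentU1 (ι := Fin 1) (convex_closedBall _ _) _ 0 (1 : Matrix (Fin 1) (Fin 1) ℝ) 0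
    LinearMap.id (ζ := fun _ => 1) (fun _ => 0) (g := 1 / 4) (Φ := 1) (cφ := 1) (γ₀ := 1) (M := 1 / 100) (d := 1)
    (by norm_num) zero_le_one (by norm_num) (fun _ => zero_le_one) le_rfl (by norm_num) one_pos ?_ ?_ ?_ ?_ ?_
  · -- hexp
    intro v _
    rw [Matrix.one_mulVec, LinearMap.zero_apply, LinearMap.id_apply]
    norm_num
  · -- h19 (1.9) as a real inequality: `1∕(2·1·1²)·Σ_b v_b² ≤ v ⬝ᵥ v`
    intro v
    unfold Ineq19
    rw [Matrix.one_mulVec]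
    simp only [dotProduct, Fin.sum_univ_one, Nat.cast_one]
    norm_num
    nlinarith [sq_nonneg (v 0)]
  · -- hwin: `|v_p| ≤ ‖v‖ ≤ 1` on the closed unit ball
    intro v hv p
    rw [LinearMap.id_apply]
    have h1 : ‖v p‖ ≤ ‖v‖ := norm_le_pi_norm v p
    rw [Real.norm_eq_abs] at h1
    exact h1.trans (mem_closedBall_zero_iff.mp hv)
  · -- hcφ: `Σ_{Fin 1} 1·v₀² ≤ 1·‖v‖²`
    intro u
    rw [LinearMap.id_apply]
    simp only [Fin.sum_univ_one, one_mul]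
    have h1 : ‖u 0‖ ≤ ‖u‖ := norm_le_pi_norm u 0
    rw [Real.norm_eq_abs] at h1
    have h2 : |u 0| ^ 2 ≤ ‖u‖ ^ 2 := pow_le_pow_left₀ (abs_nonneg _) h1 2
    rwa [sq_abs] at h2
  · -- the clause WITH EQUALITY
    norm_num

end Summit.QuantumFields.YangMills.Theorems.N21ChartExponentConvexityU1
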